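import Literature.Geometry.Lorentzian.ObstructionFreeGluing
import Mathlib.Analysis.Calculus.LineDeriv.IntegrationByParts
import Mathlib.MeasureTheory.Integral.IntervalIntegral.FundThmCalculus
import Mathlib.Analysis.SpecialFunctions.Sqrt
import Mathlib.Analysis.InnerProductSpace.Calculus
import HarnessLib

/-!
# Conservation laws for the averaged linear charges (Mao–Oh–Tao 2023, Lemma 2.7)

Y. Mao, S.-J. Oh, Z. Tao, *Initial data gluing in the asymptotically flat regime via solution operators with prescribed
support properties*, arXiv:2308.13031 [MaoOhTao2023], §2.4: the `η`-averaged charges `E, P, C, J` of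
`ObstructionFreeGluing.lean` ((1.3)–(1.7), there `MaoOhTao.avgE/avgP/avgC/avgJ`, written as volume integrals against
the radial weight `η_r(|x|) = r⁻¹ η(|x|/r)`) change between two radii `r₀`, `r₁` by the integral of the LINEARISED
constraint operators against the compactly supported radial cutoff `χ_{r₀,r₁}(|x|)`,
`χ_{r₀,r₁}(s) = ∫_0^s (η_{r₀} − η_{r₁})` ((2.10); the paper integrates from `−∞`, which is the same since `η_r`
vanishes on `(−∞, r]`).  In particular the charges of a solution of the linearised constraint equations do not depend
on the radius (loc. cit. "These quantities are conserved for solutions to the linearization of (1.1)").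

* §1 radial primitives `x ↦ ∫_0^{|x|} ψ` on `ℝ³`: gradient `ψ(|x|) x^j/|x|`, `C¹`, continuity of the partials;
* §2 integration by parts on `ℝ³` against a `C¹_c` cutoff summed over directions (Mathlib's
  `integral_mul_fderiv_eq_neg_fderiv_mul_of_integrable`), and the radial profiles `η_r` (`∫_0^s η_r = 1` for `s ≥ 2r`);
* §3 the general flux identity `integral_wt_flux_sub`:
  `∫ η_{r₁}(|x|) F_j x^j/|x| − ∫ η_{r₀}(|x|) F_j x^j/|x| = ∫ χ_{r₀,r₁}(|x|) ∂_j F_j`, and Lemma 2.7 in the averaged form: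
  `avgE_sub_avgE` (`E`-row: right-hand side `½ ∫ χ ∂_i∂_j h^{ij}`, `h_{ij} = g_{ij} − δ_{ij} − δ_{ij} tr_δ(g − δ)`),
  `avgP_sub_avgP` (`P`-rows: `∫ χ ∂_j π_{lj}`, `π = k − δ tr_δ k`), and the `C`- and `J`-rows `avgC_sub_avgC`,
  `avgJ_sub_avgJ` in the integrated-by-parts form `∫ χ Σ_j ∂_j F_j` with the fluxes of (1.5), (1.6).

* §4 the printed right-hand sides of the `C`- and `J`-rows for SYMMETRIC `g`, `k`: `x_l`, resp. the rotation `Y_l`, lies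
  in the kernel of the formal adjoint (`sum_pd_fluxC_of_symm`, `sum_pd_fluxJ_of_symm`), giving
  `avgC_sub_avgC_of_symm` (`½ ∫ χ x_l ∂_i∂_j h^{ij}`) and `avgJ_sub_avgJ_of_symm` (`∫ χ Y_l^i ∂_j π^{ij}`), together with
  the elementary calculus of the coordinate partials `MaoOhTao.pd` (sum, Leibniz, coordinates, rotations).

Deliberately NOT here: the unaveraged sphere form of Lemma 2.7 (surface integrals are not in Mathlib) and Lemma 2.8
(spacetime charges).  Regularity is taken as `C²` for `g` and `C¹` for `k` (the paper works in `H^s`, `s > 3/2`).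

Mathlib: `intervalIntegral.integral_hasDerivAt_right` (FTC), `hasStrictFDerivAt_norm_sq`, `Real.hasDerivAt_sqrt`,
`contDiffAt_norm`, `integral_mul_fderiv_eq_neg_fderiv_mul_of_integrable`, `intervalIntegral.integral_comp_div`,
`intervalIntegral.integral_eq_integral_of_support_subset`, `Continuous.integrable_of_hasCompactSupport`.
-/

noncomputable section

namespace Literature.Geometry.Lorentzian

namespace MaoOhTao

open scoped _root_.Manifold _root_.ContDiff BigOperators _root_.Topology
open _root_.MeasureTheory _root_.Filter _root_.Set intervalIntegral

/-! ## §1 Radial primitives `x ↦ ∫_0^{|x|} ψ` on `ℝ³` -/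

section RadialPrimitive

variable {ψ : ℝ → ℝ} {a : ℝ}

/-- **FTC-1 for a continuous integrand**: `s ↦ ∫_0^s ψ` has derivative `ψ(s)`. [folklore] -/
theorem hasDerivAt_primitive (hψ : Continuous ψ) (s : ℝ) :
    HasDerivAt (fun u ↦ ∫ t in (0:ℝ)..u, ψ t) (ψ s) s :=
  integral_hasDerivAt_right (hψ.intervalIntegrable _ _) (hψ.stronglyMeasurableAtFilter _ _)
    hψ.continuousAt

/-- The primitive of a continuous function is `C¹`. [folklore] -/
theorem contDiff_one_primitive (hψ : Continuous ψ) : ContDiff ℝ 1 (fun u ↦ ∫ t in (0:ℝ)..u, ψ t) := by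
  rw [contDiff_one_iff_deriv]
  refine ⟨fun s ↦ (hasDerivAt_primitive hψ s).differentiableAt, ?_⟩
  have : deriv (fun u ↦ ∫ t in (0:ℝ)..u, ψ t) = ψ := funext fun s ↦ (hasDerivAt_primitive hψ s).deriv
  rw [this]
  exact hψ

/-- If `ψ` vanishes on `(-∞, a]`, `a ≥ 0`, then so does its primitive from `0`. [folklore] -/
theorem primitive_eq_zero_of_le (hψa : ∀ t, t ≤ a → ψ t = 0) (ha : 0 ≤ a) {s : ℝ} (hs : s ≤ a) :
    ∫ t in (0:ℝ)..s, ψ t = 0 := by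
  have h : EqOn ψ (fun _ ↦ (0:ℝ)) (uIcc 0 s) := by
    intro t ht
    rw [mem_uIcc] at ht
    have : t ≤ a := by
      rcases ht with ⟨-, h2⟩ | ⟨-, h2⟩
      · exact h2.trans hs
      · exact h2.trans ha
    exact hψa t this
  rw [integral_congr h]
  simp

/-- The Euclidean norm on `ℝ³` has derivative `v ↦ ⟨x, v⟩ / |x|` away from the origin (chain rule through
`|x| = √(|x|²)`). [folklore] -/
theorem hasFDerivAt_norm_E3 {x : E3} (hx : x ≠ 0) :
    HasFDerivAt (fun y : E3 ↦ ‖y‖) (‖x‖⁻¹ • (innerSL ℝ x : E3 →L[ℝ] ℝ)) x := by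
  have h3 := (Real.hasDerivAt_sqrt (pow_ne_zero 2 (norm_ne_zero_iff.2 hx))).comp_hasFDerivAt x
    (hasStrictFDerivAt_norm_sq x).hasFDerivAt
  have heq : ((fun u : ℝ ↦ Real.sqrt u) ∘ fun y : E3 ↦ ‖y‖ ^ 2) = fun y ↦ ‖y‖ :=
    funext fun y ↦ Real.sqrt_sq (norm_nonneg y)
  rw [heq, Real.sqrt_sq (norm_nonneg x)] at h3
  refine h3.congr_fderiv ?_
  ext v
  have hx' : ‖x‖ ≠ 0 := norm_ne_zero_iff.2 hx
  simp only [FunLike.coe_smul, Pi.smul_apply]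
  simp only [smul_eq_mul, nsmul_eq_mul, Nat.cast_ofNat]
  field_simp

/-- **Gradient of a radial primitive.** For `ψ` continuous and vanishing on `(-∞, a]`, `a > 0`, the radial function
`x ↦ ∫_0^{|x|} ψ` is differentiable on all of `ℝ³` with derivative `v ↦ ψ(|x|) ⟨x, v⟩ / |x|` (it vanishes identically
on the ball `B_a`, where the formula gives `0`). This is `∂_j χ_r(|x|) = η_r(|x|) x^j / |x|` behind Mao–Oh–Tao's (2.10).
[folklore] -/
theorem hasFDerivAt_radialPrimitive (hψ : Continuous ψ) (ha : 0 < a) (hψa : ∀ t, t ≤ a → ψ t = 0)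
    (x : E3) :
    HasFDerivAt (fun y : E3 ↦ ∫ t in (0:ℝ)..‖y‖, ψ t)
      ((ψ ‖x‖ * ‖x‖⁻¹) • (innerSL ℝ x : E3 →L[ℝ] ℝ)) x := by
  by_cases hx : ‖x‖ < a
  · have hev : (fun y : E3 ↦ ∫ t in (0:ℝ)..‖y‖, ψ t) =ᶠ[𝓝 x] fun _ ↦ (0:ℝ) := by
      have : ∀ᶠ y in 𝓝 x, ‖y‖ < a :=
        (isOpen_lt continuous_norm continuous_const).mem_nhds (by simpa using hx)
      exact this.mono fun y hy ↦ primitive_eq_zero_of_le hψa ha.le hy.le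
    rw [hψa _ hx.le, zero_mul, zero_smul]
    exact (hasFDerivAt_const (0:ℝ) x).congr_of_eventuallyEq hev
  · have hxa : a ≤ ‖x‖ := not_lt.1 hx
    have hx0 : x ≠ 0 := by
      intro h
      rw [h, norm_zero] at hxa
      linarith
    have h := (hasDerivAt_primitive hψ ‖x‖).comp_hasFDerivAt x (hasFDerivAt_norm_E3 hx0)
    rw [smul_smul] at h
    exact h

/-- Coordinate form of the gradient of a radial primitive: `∂_j ∫_0^{|x|} ψ = ψ(|x|) x^j / |x|`. [folklore] -/
theorem fderiv_radialPrimitive_apply (hψ : Continuous ψ) (ha : 0 < a) (hψa : ∀ t, t ≤ a → ψ t = 0)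
    (x : E3) (j : Fin 3) :
    fderiv ℝ (fun y : E3 ↦ ∫ t in (0:ℝ)..‖y‖, ψ t) x (e j) = ψ ‖x‖ * (x j / ‖x‖) := by
  rw [(hasFDerivAt_radialPrimitive hψ ha hψa x).fderiv]
  simp only [FunLike.coe_smul, Pi.smul_apply, smul_eq_mul, innerSL_apply_apply, e,
    EuclideanSpace.inner_single_right]
  simp [div_eq_mul_inv]
  ring

/-- A radial primitive of a continuous `ψ` vanishing on `(-∞, a]`, `a > 0`, is `C¹` on `ℝ³` (composition with the
norm away from the origin, identically zero near it). [folklore] -/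
theorem contDiff_radialPrimitive (hψ : Continuous ψ) (ha : 0 < a) (hψa : ∀ t, t ≤ a → ψ t = 0) :
    ContDiff ℝ 1 (fun y : E3 ↦ ∫ t in (0:ℝ)..‖y‖, ψ t) := by
  refine contDiff_iff_contDiffAt.2 fun x ↦ ?_
  by_cases hx : ‖x‖ < a
  · have hev : (fun y : E3 ↦ ∫ t in (0:ℝ)..‖y‖, ψ t) =ᶠ[𝓝 x] fun _ ↦ (0:ℝ) := by
      have : ∀ᶠ y in 𝓝 x, ‖y‖ < a :=
        (isOpen_lt continuous_norm continuous_const).mem_nhds (by simpa using hx)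
      exact this.mono fun y hy ↦ primitive_eq_zero_of_le hψa ha.le hy.le
    exact contDiffAt_const.congr_of_eventuallyEq hev
  · have hxa : a ≤ ‖x‖ := not_lt.1 hx
    have hx0 : x ≠ 0 := by
      intro h
      rw [h, norm_zero] at hxa
      linarith
    exact (contDiff_one_primitive hψ).contDiffAt.comp x (contDiffAt_norm ℝ hx0)

/-- A radial primitive (as above) is differentiable on `ℝ³`. [folklore] -/
theorem differentiable_radialPrimitive (hψ : Continuous ψ) (ha : 0 < a) (hψa : ∀ t, t ≤ a → ψ t = 0) :
    Differentiable ℝ (fun y : E3 ↦ ∫ t in (0:ℝ)..‖y‖, ψ t) :=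
  fun x ↦ (hasFDerivAt_radialPrimitive hψ ha hψa x).differentiableAt

/-- The partial derivatives of a radial primitive (as above) are continuous on `ℝ³`. [folklore] -/
theorem continuous_fderiv_radialPrimitive_apply (hψ : Continuous ψ) (ha : 0 < a)
    (hψa : ∀ t, t ≤ a → ψ t = 0) (v : E3) :
    Continuous fun x : E3 ↦ fderiv ℝ (fun y : E3 ↦ ∫ t in (0:ℝ)..‖y‖, ψ t) x v :=
  ((contDiff_radialPrimitive hψ ha hψa).continuous_fderiv one_ne_zero).clm_apply continuous_const

end RadialPrimitive

/-! ## §2 Integration by parts against a `C¹_c` cutoff; the radial profiles `η_r` -/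

section IBP

/-- **Integration by parts on `ℝ³` against a compactly supported `C¹` cutoff, summed over the coordinate directions**
(the divergence theorem in the form used for conservation laws): for `H ∈ C¹_c(ℝ³)` and `C¹` functions
`F_1, F_2, F_3`, `∫ Σ_j ∂_j H · F_j = − ∫ H Σ_j ∂_j F_j` (Mathlib's `integral_mul_fderiv_eq_neg_fderiv_mul_of_integrable`
in each direction `e_j`). [folklore] -/
theorem integral_sum_fderiv_mul_eq_neg_integral_mul_sum_fderiv {H : E3 → ℝ} (hH : ContDiff ℝ 1 H)
    (hHc : HasCompactSupport H) {F : Fin 3 → E3 → ℝ} (hF : ∀ j, ContDiff ℝ 1 (F j)) :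
    ∫ x, ∑ j, fderiv ℝ H x (e j) * F j x = - ∫ x, H x * ∑ j, fderiv ℝ (F j) x (e j) := by
  have hHd : Differentiable ℝ H := hH.differentiable one_ne_zero
  have hFd : ∀ j, Differentiable ℝ (F j) := fun j ↦ (hF j).differentiable one_ne_zero
  have hH' : ∀ j, Continuous fun x ↦ fderiv ℝ H x (e j) := fun j ↦
    (hH.continuous_fderiv one_ne_zero).clm_apply continuous_const
  have hF' : ∀ j, Continuous fun x ↦ fderiv ℝ (F j) x (e j) := fun j ↦
    ((hF j).continuous_fderiv one_ne_zero).clm_apply continuous_const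
  have hH'c : ∀ j, HasCompactSupport fun x ↦ fderiv ℝ H x (e j) := fun j ↦
    (hHc.fderiv ℝ).comp_left (g := fun L : E3 →L[ℝ] ℝ ↦ L (e j)) rfl
  -- integrability of the three products, direction by direction
  have i1 : ∀ j, Integrable (fun x ↦ fderiv ℝ H x (e j) * F j x) := fun j ↦
    ((hH' j).mul (hF j).continuous).integrable_of_hasCompactSupport (hH'c j).mul_right
  have i2 : ∀ j, Integrable (fun x ↦ H x * fderiv ℝ (F j) x (e j)) := fun j ↦
    (hH.continuous.mul (hF' j)).integrable_of_hasCompactSupport hHc.mul_right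
  have i3 : ∀ j, Integrable (fun x ↦ H x * F j x) := fun j ↦
    (hH.continuous.mul (hF j).continuous).integrable_of_hasCompactSupport hHc.mul_right
  have key : ∀ j, ∫ x, fderiv ℝ H x (e j) * F j x = - ∫ x, H x * fderiv ℝ (F j) x (e j) := by
    intro j
    have h := integral_mul_fderiv_eq_neg_fderiv_mul_of_integrable (μ := volume) (f := H) (g := F j)
      (v := e j) ?_ (i2 j) (i3 j) (fun x _ ↦ hHd x) (fun x _ ↦ hFd j x)
    · rw [h, neg_neg]
    · simpa [mul_comm] using i1 j
  calc ∫ x, ∑ j, fderiv ℝ H x (e j) * F j x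
      = ∑ j, ∫ x, fderiv ℝ H x (e j) * F j x := integral_finsetSum _ fun j _ ↦ i1 j
    _ = ∑ j, -∫ x, H x * fderiv ℝ (F j) x (e j) := Finset.sum_congr rfl fun j _ ↦ key j
    _ = -∫ x, ∑ j, H x * fderiv ℝ (F j) x (e j) := by
        rw [Finset.sum_neg_distrib, integral_finsetSum _ fun j _ ↦ i2 j]
    _ = -∫ x, H x * ∑ j, fderiv ℝ (F j) x (e j) := by
        congr 1
        exact integral_congr_ae (Eventually.of_forall fun x ↦ by simp [Finset.mul_sum])

end IBP

section Weights

variable {η : ℝ → ℝ}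

/-- The radial profile `t ↦ r⁻¹ η(t/r)` of the weight `η_r` is continuous. [cite: MaoOhTao2023, §1.2 (1.7)] -/
theorem continuous_wt1 (hη : IsBump η) (r : ℝ) : Continuous fun t : ℝ ↦ r⁻¹ * η (t / r) :=
  continuous_const.mul (hη.1.continuous.comp (continuous_id.div_const r))

/-- The profile `η_r` vanishes on `(-∞, r]` (`supp η ⊆ [1, 2]`). [cite: MaoOhTao2023, §1.2 (1.7)] -/
theorem wt1_eq_zero_of_le (hη : IsBump η) {r : ℝ} (hr : 0 < r) {t : ℝ} (ht : t ≤ r) :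
    r⁻¹ * η (t / r) = 0 := by
  have : t / r ≤ 1 := by rwa [div_le_one hr]
  simp [hη.2.1 _ this]

/-- The profile `η_r` vanishes on `[2r, ∞)` (`supp η ⊆ [1, 2]`). [cite: MaoOhTao2023, §1.2 (1.7)] -/
theorem wt1_eq_zero_of_ge (hη : IsBump η) {r : ℝ} (hr : 0 < r) {t : ℝ} (ht : 2 * r ≤ t) :
    r⁻¹ * η (t / r) = 0 := by
  have : 2 ≤ t / r := by rwa [le_div_iff₀ hr]
  simp [hη.2.2.1 _ this]

/-- `∫_0^s η_r = ∫ η = 1` for `s ≥ 2r` (substitution `t = r u`). [cite: MaoOhTao2023, §1.2 (1.7)] -/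
theorem integral_wt1_eq_one (hη : IsBump η) {r : ℝ} (hr : 0 < r) {s : ℝ} (hs : 2 * r ≤ s) :
    ∫ t in (0:ℝ)..s, r⁻¹ * η (t / r) = 1 := by
  rw [intervalIntegral.integral_const_mul, intervalIntegral.integral_comp_div _ hr.ne']
  simp only [zero_div, smul_eq_mul]
  rw [← mul_assoc, inv_mul_cancel₀ hr.ne', one_mul]
  have hsupp : Function.support η ⊆ Ioc 0 (s / r) := by
    intro t ht
    rw [Function.mem_support] at ht
    have h1 : ¬ t ≤ 1 := fun h ↦ ht (hη.2.1 t h)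
    have h2 : ¬ 2 ≤ t := fun h ↦ ht (hη.2.2.1 t h)
    have h3 : 2 ≤ s / r := by rwa [le_div_iff₀ hr]
    constructor <;> [linarith; linarith [not_le.1 h1, not_le.1 h2]]
  rw [intervalIntegral.integral_eq_integral_of_support_subset hsupp]
  exact hη.2.2.2

end Weights

/-! ## §3 Lemma 2.7: the conservation identities for the averaged charges -/

section ChargeIdentities

variable {η : ℝ → ℝ} {r r₀ r₁ a : ℝ} {g k : E3 → E3 →L[ℝ] E3 →L[ℝ] ℝ}

/-- The components `g_{ij}` of a `C^n` coefficient field are `C^n`. [folklore] -/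
theorem contDiff_cmp {n : ℕ∞ω} (hg : ContDiff ℝ n g) (i j : Fin 3) : ContDiff ℝ n (cmp g i j) := by
  unfold cmp
  exact (hg.clm_apply contDiff_const).clm_apply contDiff_const

/-- The coordinate partial derivatives `∂_l f` of a `C^{n+1}` function are `C^n`. [folklore] -/
theorem contDiff_pd {n : ℕ} {f : E3 → ℝ} (hf : ContDiff ℝ (n + 1) f) (l : Fin 3) :
    ContDiff ℝ n (pd l f) := by
  unfold pd
  exact (hf.fderiv_right (m := n) le_rfl).clm_apply contDiff_const

/-- The flux integrands against a single radial weight are integrable (continuous, supported in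
`B̄_{2r}`). [folklore] -/
theorem integrable_fderiv_radialPrimitive_mul (hη : IsBump η) (hr : 0 < r) (ha : 0 < a)
    (hψa : ∀ t, t ≤ a → r⁻¹ * η (t / r) = 0) {G : E3 → ℝ} (hG : Continuous G) (j : Fin 3) :
    Integrable fun x : E3 ↦
      fderiv ℝ (fun y : E3 ↦ ∫ t in (0:ℝ)..‖y‖, r⁻¹ * η (t / r)) x (e j) * G x := by
  have hc := continuous_wt1 hη r
  refine ((continuous_fderiv_radialPrimitive_apply hc ha hψa (e j)).mul hG).integrable_of_hasCompactSupport
    ?_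
  refine HasCompactSupport.intro (isCompact_closedBall (0 : E3) (2 * r)) fun x hx ↦ ?_
  have hx' : 2 * r ≤ ‖x‖ := by
    rw [Metric.mem_closedBall, dist_zero_right, not_le] at hx
    exact hx.le
  simp only [Pi.mul_apply]
  rw [fderiv_radialPrimitive_apply hc ha hψa, wt1_eq_zero_of_ge hη hr hx']
  simp

/-- A flux integral against one radial weight, rewritten against the gradient of the radial primitive:
`η_r(|x|) Σ_j F_j(x) x^j/|x| = Σ_j ∂_j χ_r(|x|) F_j(x)`. [folklore] -/
theorem wt_mul_sum_eq_sum_fderiv_mul (hη : IsBump η) (ha : 0 < a)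
    (hψa : ∀ t, t ≤ a → r⁻¹ * η (t / r) = 0) (F : Fin 3 → E3 → ℝ) (x : E3) :
    wt η r x * ∑ j, F j x * (x j / ‖x‖) =
      ∑ j, fderiv ℝ (fun y : E3 ↦ ∫ t in (0:ℝ)..‖y‖, r⁻¹ * η (t / r)) x (e j) * F j x := by
  simp only [fderiv_radialPrimitive_apply (continuous_wt1 hη r) ha hψa, wt, Finset.mul_sum]
  refine Finset.sum_congr rfl fun j _ ↦ ?_
  ring

/-- **Integration by parts behind Lemma 2.7** (Mao–Oh–Tao 2023, Lemma 2.7, averaged form, for a general flux): for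
`C¹` functions `F_1, F_2, F_3` on `ℝ³` and radii `r₀, r₁ > 0`,
`∫ η_{r₁}(|x|) F_j x^j/|x| dx − ∫ η_{r₀}(|x|) F_j x^j/|x| dx = ∫ χ_{r₀,r₁}(|x|) ∂_j F_j (x) dx` with the compactly
supported cutoff `χ_{r₀,r₁}(s) = ∫_0^s (η_{r₀} − η_{r₁})` ((2.10); `η_r(|x|) x^j/|x| = ∂_j ∫_0^{|x|} η_r`, and
`∫_0^s η_r = 1` for `s ≥ 2r`). The four charge identities of Lemma 2.7 are this with the fluxes of (1.3)–(1.6).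
[cite: MaoOhTao2023, Lemma 2.7] -/
theorem integral_wt_flux_sub (hη : IsBump η) (hr₀ : 0 < r₀) (hr₁ : 0 < r₁) {F : Fin 3 → E3 → ℝ}
    (hF : ∀ j, ContDiff ℝ 1 (F j)) :
    (∫ x : E3, wt η r₁ x * ∑ j, F j x * (x j / ‖x‖)) - ∫ x : E3, wt η r₀ x * ∑ j, F j x * (x j / ‖x‖) =
      ∫ x : E3, (∫ t in (0:ℝ)..‖x‖, (r₀⁻¹ * η (t / r₀) - r₁⁻¹ * η (t / r₁))) *
        ∑ j, fderiv ℝ (F j) x (e j) := by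
  -- the weights, their common vanishing radius `a`, and their primitives
  set a : ℝ := min r₀ r₁ with ha_def
  have ha : 0 < a := lt_min hr₀ hr₁
  have hψ₀c : Continuous fun t : ℝ ↦ r₀⁻¹ * η (t / r₀) := continuous_wt1 hη r₀
  have hψ₁c : Continuous fun t : ℝ ↦ r₁⁻¹ * η (t / r₁) := continuous_wt1 hη r₁
  have hψ₀a : ∀ t, t ≤ a → r₀⁻¹ * η (t / r₀) = 0 := fun t ht ↦
    wt1_eq_zero_of_le hη hr₀ (ht.trans (min_le_left _ _))
  have hψ₁a : ∀ t, t ≤ a → r₁⁻¹ * η (t / r₁) = 0 := fun t ht ↦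
    wt1_eq_zero_of_le hη hr₁ (ht.trans (min_le_right _ _))
  set ψ : ℝ → ℝ := fun t ↦ r₀⁻¹ * η (t / r₀) - r₁⁻¹ * η (t / r₁) with hψ
  have hψc : Continuous ψ := hψ₀c.sub hψ₁c
  have hψa : ∀ t, t ≤ a → ψ t = 0 := fun t ht ↦ by simp [hψ, hψ₀a t ht, hψ₁a t ht]
  set H₀ : E3 → ℝ := fun x ↦ ∫ t in (0:ℝ)..‖x‖, r₀⁻¹ * η (t / r₀) with hH₀
  set H₁ : E3 → ℝ := fun x ↦ ∫ t in (0:ℝ)..‖x‖, r₁⁻¹ * η (t / r₁) with hH₁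
  set H : E3 → ℝ := fun x ↦ ∫ t in (0:ℝ)..‖x‖, ψ t with hH
  -- `H = H₀ − H₁`, with gradient the difference of the gradients
  have hHfun : H = fun x ↦ H₀ x - H₁ x := by
    funext x
    simp only [hH, hH₀, hH₁, hψ]
    exact intervalIntegral.integral_sub (hψ₀c.intervalIntegrable _ _) (hψ₁c.intervalIntegrable _ _)
  have hHd : ∀ x, fderiv ℝ H x = fderiv ℝ H₀ x - fderiv ℝ H₁ x := fun x ↦ by
    rw [hHfun]
    exact fderiv_fun_sub ((differentiable_radialPrimitive hψ₀c ha hψ₀a) x)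
      ((differentiable_radialPrimitive hψ₁c ha hψ₁a) x)
  -- `H` is `C¹` with compact support (both primitives are `1` beyond `2 max r₀ r₁`)
  have hHC : ContDiff ℝ 1 H := contDiff_radialPrimitive hψc ha hψa
  have hHc : HasCompactSupport H := by
    refine HasCompactSupport.intro (isCompact_closedBall (0 : E3) (2 * max r₀ r₁)) fun x hx ↦ ?_
    have hx' : 2 * max r₀ r₁ ≤ ‖x‖ := by
      rw [Metric.mem_closedBall, dist_zero_right, not_le] at hx
      exact hx.le
    have h0 : 2 * r₀ ≤ ‖x‖ := le_trans (by linarith [le_max_left r₀ r₁]) hx'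
    have h1 : 2 * r₁ ≤ ‖x‖ := le_trans (by linarith [le_max_right r₀ r₁]) hx'
    rw [hHfun]
    simp only [hH₀, hH₁, integral_wt1_eq_one hη hr₀ h0, integral_wt1_eq_one hη hr₁ h1, sub_self]
  -- Step 1: both flux integrals against the gradients of the primitives; they are integrable
  have i0 : Integrable fun x : E3 ↦ ∑ j, fderiv ℝ H₀ x (e j) * F j x :=
    integrable_finsetSum _ fun j _ ↦
      integrable_fderiv_radialPrimitive_mul hη hr₀ ha hψ₀a (hF j).continuous j
  have i1 : Integrable fun x : E3 ↦ ∑ j, fderiv ℝ H₁ x (e j) * F j x :=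
    integrable_finsetSum _ fun j _ ↦
      integrable_fderiv_radialPrimitive_mul hη hr₁ ha hψ₁a (hF j).continuous j
  have e0 : ∫ x : E3, wt η r₀ x * ∑ j, F j x * (x j / ‖x‖) = ∫ x, ∑ j, fderiv ℝ H₀ x (e j) * F j x :=
    integral_congr_ae (Eventually.of_forall fun x ↦ wt_mul_sum_eq_sum_fderiv_mul hη ha hψ₀a F x)
  have e1 : ∫ x : E3, wt η r₁ x * ∑ j, F j x * (x j / ‖x‖) = ∫ x, ∑ j, fderiv ℝ H₁ x (e j) * F j x :=
    integral_congr_ae (Eventually.of_forall fun x ↦ wt_mul_sum_eq_sum_fderiv_mul hη ha hψ₁a F x)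
  -- Step 2: integrate by parts against `H`
  have ibp := integral_sum_fderiv_mul_eq_neg_integral_mul_sum_fderiv hHC hHc hF
  rw [e1, e0, ← integral_sub i1 i0]
  have hpt : ∀ x, (∑ j, fderiv ℝ H₁ x (e j) * F j x) - ∑ j, fderiv ℝ H₀ x (e j) * F j x =
      -(∑ j, fderiv ℝ H x (e j) * F j x) := by
    intro x
    rw [← Finset.sum_neg_distrib, ← Finset.sum_sub_distrib]
    refine Finset.sum_congr rfl fun j _ ↦ ?_
    rw [hHd x]
    simp only [FunLike.coe_sub, Pi.sub_apply]
    ring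
  simp_rw [hpt, _root_.MeasureTheory.integral_neg, ibp, neg_neg]
  rfl

/-- **Conservation identity for the averaged linear energy** (Mao–Oh–Tao 2023, Lemma 2.7, first identity, `E`-row, in
the averaged form): for a `C²` coefficient field `g` on `ℝ³` and radii `r₀, r₁ > 0`,
`E[g; A_{r₁}] − E[g; A_{r₀}] = ½ ∫ χ_{r₀,r₁}(|x|) Σ_{i,j} (∂_j ∂_i g_{ij} − ∂_j ∂_j g_{ii})(x) dx`, where
`χ_{r₀,r₁}(s) = ∫_0^s (η_{r₀} − η_{r₁})` and `Σ_{i,j} (∂_j∂_i g_{ij} − ∂_j∂_j g_{ii}) = ∂_i ∂_j h^{ij}` is the linearised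
scalar curvature (`h_{ij} = g_{ij} − δ_{ij} − δ_{ij} tr_δ(g − δ)`, loc. cit. (2.1), (2.3)); in particular the averaged
energy does not depend on the radius across a region where the linearised Hamiltonian constraint holds.  Proof as
printed: integration by parts (`integral_wt_flux_sub` with the flux `F_j = Σ_i (∂_i g_{ij} − ∂_j g_{ii})` of (1.3)).
[cite: MaoOhTao2023, Lemma 2.7] -/
theorem avgE_sub_avgE (hη : IsBump η) (hr₀ : 0 < r₀) (hr₁ : 0 < r₁) (hg : ContDiff ℝ 2 g) :
    avgE η r₁ g - avgE η r₀ g =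
      (1 / 2) * ∫ x : E3, (∫ t in (0:ℝ)..‖x‖, (r₀⁻¹ * η (t / r₀) - r₁⁻¹ * η (t / r₁))) *
        ∑ i, ∑ j, (pd j (pd i (cmp g i j)) x - pd j (pd j (cmp g i i)) x) := by
  -- the flux `F j = Σ_i (∂_i g_ij − ∂_j g_ii)` is `C¹`
  set F : Fin 3 → E3 → ℝ := fun j x ↦ ∑ i, (pd i (cmp g i j) x - pd j (cmp g i i) x) with hF
  have hpd : ∀ i j l, ContDiff ℝ 1 (pd l (cmp g i j)) := fun i j l ↦ contDiff_pd (contDiff_cmp hg i j) l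
  have hFc : ∀ j, ContDiff ℝ 1 (F j) := fun j ↦ ContDiff.sum fun i _ ↦ (hpd i j i).sub (hpd i i j)
  -- the averaged energies are flux integrals of `F`
  have havg : ∀ ρ : ℝ, avgE η ρ g = (1 / 2) * ∫ x : E3, wt η ρ x * ∑ j, F j x * (x j / ‖x‖) := by
    intro ρ
    unfold avgE
    congr 1
    refine integral_congr_ae (Eventually.of_forall fun x ↦ ?_)
    simp only [hF, Finset.sum_mul]
    rw [Finset.sum_comm]
  -- the divergence of the flux is the linearised scalar curvature
  have hdiv : ∀ x, ∑ j, fderiv ℝ (F j) x (e j) =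
      ∑ i, ∑ j, (pd j (pd i (cmp g i j)) x - pd j (pd j (cmp g i i)) x) := by
    intro x
    rw [Finset.sum_comm]
    refine Finset.sum_congr rfl fun j _ ↦ ?_
    have h : HasFDerivAt (F j)
        (∑ i, (fderiv ℝ (pd i (cmp g i j)) x - fderiv ℝ (pd j (cmp g i i)) x)) x := by
      simp only [hF]
      exact HasFDerivAt.fun_sum fun i _ ↦
        (((hpd i j i).differentiable one_ne_zero) x).hasFDerivAt.sub
          (((hpd i i j).differentiable one_ne_zero) x).hasFDerivAt
    rw [h.fderiv, _root_.sum_apply]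
    refine Finset.sum_congr rfl fun i _ ↦ ?_
    rfl
  rw [havg r₁, havg r₀, ← mul_sub, integral_wt_flux_sub hη hr₀ hr₁ hFc]
  simp_rw [hdiv]

/-- The Euclidean trace of a `C^n` coefficient field is `C^n`. [folklore] -/
theorem contDiff_trδ {n : ℕ∞ω} (hk : ContDiff ℝ n k) : ContDiff ℝ n (trδ k) := by
  unfold trδ
  exact ContDiff.sum fun i _ ↦ contDiff_cmp hk i i

/-- The coordinate functions of `ℝ³` are smooth (`EuclideanSpace.proj`). [folklore] -/
theorem contDiff_coord {n : ℕ∞ω} (l : Fin 3) : ContDiff ℝ n (fun x : E3 ↦ x l) :=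
  (EuclideanSpace.proj (𝕜 := ℝ) l).contDiff

/-- The components of the rotation fields `Y_l = e_l × x` are smooth (linear) functions on `ℝ³`.
[cite: MaoOhTao2023, §1.1] -/
theorem contDiff_rotGen {n : ℕ∞ω} (l i : Fin 3) : ContDiff ℝ n (fun x : E3 ↦ rotGen l x i) := by
  fin_cases i
  · simp only [rotGen, Fin.zero_eta, Matrix.cons_val_zero]
    exact ((contDiff_const.mul (contDiff_coord 2)).sub (contDiff_const.mul (contDiff_coord 1)))
  · simp only [rotGen, Fin.mk_one, Matrix.cons_val_one, Matrix.cons_val_zero]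
    exact ((contDiff_const.mul (contDiff_coord 0)).sub (contDiff_const.mul (contDiff_coord 2)))
  · simp only [rotGen, Fin.reduceFinMk, Matrix.cons_val]
    exact ((contDiff_const.mul (contDiff_coord 1)).sub (contDiff_const.mul (contDiff_coord 0)))

/-- **Conservation identity for the averaged linear momentum** (Mao–Oh–Tao 2023, Lemma 2.7, second identity, `P`-rows,
averaged form): for a `C¹` coefficient field `k` on `ℝ³`, radii `r₀, r₁ > 0` and `l = 1, 2, 3`,
`P_l[k; A_{r₁}] − P_l[k; A_{r₀}] = ∫ χ_{r₀,r₁}(|x|) Σ_j ∂_j π_{lj}(x) dx` with `π_{lj} = k_{lj} − δ_{lj} tr_δ k` ((2.1)) — the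
linearised momentum constraint operator integrated against the cutoff; in particular `P_l` does not depend on the
radius across a region where `∂_j π_{lj} = 0`. [cite: MaoOhTao2023, Lemma 2.7] -/
theorem avgP_sub_avgP (hη : IsBump η) (hr₀ : 0 < r₀) (hr₁ : 0 < r₁) (hk : ContDiff ℝ 1 k) (l : Fin 3) :
    avgP η r₁ k l - avgP η r₀ k l =
      ∫ x : E3, (∫ t in (0:ℝ)..‖x‖, (r₀⁻¹ * η (t / r₀) - r₁⁻¹ * η (t / r₁))) *
        ∑ j, pd j (fun y ↦ cmp k l j y - (if l = j then trδ k y else 0)) x := by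
  set F : Fin 3 → E3 → ℝ := fun j y ↦ cmp k l j y - (if l = j then trδ k y else 0) with hF
  have hFc : ∀ j, ContDiff ℝ 1 (F j) := by
    intro j
    by_cases h : l = j
    · subst h
      simp only [hF, if_true]
      exact (contDiff_cmp hk l l).sub (contDiff_trδ hk)
    · simp only [hF, h, if_false, sub_zero]
      exact contDiff_cmp hk l j
  have havg : ∀ ρ : ℝ, avgP η ρ k l = ∫ x : E3, wt η ρ x * ∑ j, F j x * (x j / ‖x‖) := fun ρ ↦ rfl
  rw [havg r₁, havg r₀, integral_wt_flux_sub hη hr₀ hr₁ hFc]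
  rfl

/-- **Integration-by-parts identity for the averaged centre of mass** (Mao–Oh–Tao 2023, Lemma 2.7, first identity,
`C`-rows, averaged form, before the simplification "`x_l` lies in the kernel of the adjoint of `h ↦ ∂_i ∂_j h^{ij}`"):
for a `C²` coefficient field `g`, radii `r₀, r₁ > 0` and `l = 1, 2, 3`,
`C_l[g; A_{r₁}] − C_l[g; A_{r₀}] = ½ ∫ χ_{r₀,r₁}(|x|) Σ_j ∂_j F^C_j (x) dx` with the centre-of-mass flux
`F^C_j = Σ_i (x_l ∂_i g_{ij} − x_l ∂_j g_{ii} − δ_{il}(g_{ij} − δ_{ij}) + δ_{jl}(g_{ii} − δ_{ii}))` of (1.5); for symmetric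
`g` one has `Σ_j ∂_j F^C_j = x_l ∂_i ∂_j h^{ij}`, which is the printed right-hand side.
-- TODO(printed form): the symmetric simplification `Σ_j ∂_j F^C_j = x_l ∂_i∂_j h^{ij}`.
[cite: MaoOhTao2023, Lemma 2.7] -/
theorem avgC_sub_avgC (hη : IsBump η) (hr₀ : 0 < r₀) (hr₁ : 0 < r₁) (hg : ContDiff ℝ 2 g) (l : Fin 3) :
    avgC η r₁ g l - avgC η r₀ g l =
      (1 / 2) * ∫ x : E3, (∫ t in (0:ℝ)..‖x‖, (r₀⁻¹ * η (t / r₀) - r₁⁻¹ * η (t / r₁))) *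
        ∑ j, pd j (fun y : E3 ↦ ∑ i, (y l * pd i (cmp g i j) y - y l * pd j (cmp g i i) y
            - (if i = l then cmp g i j y - (if i = j then 1 else 0) else 0)
            + (if j = l then cmp g i i y - 1 else 0))) x := by
  set F : Fin 3 → E3 → ℝ := fun j y ↦ ∑ i, (y l * pd i (cmp g i j) y - y l * pd j (cmp g i i) y
      - (if i = l then cmp g i j y - (if i = j then 1 else 0) else 0)
      + (if j = l then cmp g i i y - 1 else 0)) with hF
  have hcmp : ∀ i j, ContDiff ℝ 1 (cmp g i j) := fun i j ↦ (contDiff_cmp hg i j).of_le (by norm_num)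
  have hpd : ∀ i j m, ContDiff ℝ 1 (pd m (cmp g i j)) := fun i j m ↦ contDiff_pd (contDiff_cmp hg i j) m
  have hFc : ∀ j, ContDiff ℝ 1 (F j) := by
    intro j
    refine ContDiff.sum fun i _ ↦ ?_
    have h1 : ContDiff ℝ 1 fun y : E3 ↦ y l * pd i (cmp g i j) y - y l * pd j (cmp g i i) y :=
      ((contDiff_coord l).mul (hpd i j i)).sub ((contDiff_coord l).mul (hpd i i j))
    have h2 : ContDiff ℝ 1 fun y : E3 ↦ (if i = l then cmp g i j y - (if i = j then 1 else 0) else 0) := by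
      by_cases h : i = l
      · simp only [h, if_true]
        exact (hcmp l j).sub contDiff_const
      · simp only [h, if_false]
        exact contDiff_const
    have h3 : ContDiff ℝ 1 fun y : E3 ↦ (if j = l then cmp g i i y - 1 else 0) := by
      by_cases h : j = l
      · simp only [h, if_true]
        exact (hcmp i i).sub contDiff_const
      · simp only [h, if_false]
        exact contDiff_const
    exact (h1.sub h2).add h3
  have havg : ∀ ρ : ℝ, avgC η ρ g l = (1 / 2) * ∫ x : E3, wt η ρ x * ∑ j, F j x * (x j / ‖x‖) := by
    intro ρ
    unfold avgC
    congr 1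
    refine integral_congr_ae (Eventually.of_forall fun x ↦ ?_)
    simp only [hF, Finset.sum_mul]
    rw [Finset.sum_comm]
  rw [havg r₁, havg r₀, ← mul_sub, integral_wt_flux_sub hη hr₀ hr₁ hFc]
  rfl

/-- **Integration-by-parts identity for the averaged angular momentum** (Mao–Oh–Tao 2023, Lemma 2.7, second identity,
`J`-rows, averaged form, before the simplification "`Y_l` lies in the kernel of the adjoint of `π ↦ ∂_i π^{ij}`"): for a
`C¹` coefficient field `k`, radii `r₀, r₁ > 0` and `l = 1, 2, 3`,
`J_l[k; A_{r₁}] − J_l[k; A_{r₀}] = ∫ χ_{r₀,r₁}(|x|) Σ_j ∂_j F^J_j (x) dx` with the angular-momentum flux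
`F^J_j = Σ_i (k_{ij} − δ_{ij} tr_δ k) Y_l^i` of (1.6); for symmetric `k`, `Σ_j ∂_j F^J_j = Σ_i Y_l^i ∂_j π^{ij}` (the
rotations `Y_l` are Killing for `δ`), which is the printed right-hand side.
-- TODO(printed form): the symmetric simplification `Σ_j ∂_j F^J_j = Y_l^i ∂_j π^{ij}`.
[cite: MaoOhTao2023, Lemma 2.7] -/
theorem avgJ_sub_avgJ (hη : IsBump η) (hr₀ : 0 < r₀) (hr₁ : 0 < r₁) (hk : ContDiff ℝ 1 k) (l : Fin 3) :
    avgJ η r₁ k l - avgJ η r₀ k l =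
      ∫ x : E3, (∫ t in (0:ℝ)..‖x‖, (r₀⁻¹ * η (t / r₀) - r₁⁻¹ * η (t / r₁))) *
        ∑ j, pd j (fun y : E3 ↦ ∑ i, (cmp k i j y - (if i = j then trδ k y else 0)) * rotGen l y i) x := by
  set F : Fin 3 → E3 → ℝ := fun j y ↦ ∑ i, (cmp k i j y - (if i = j then trδ k y else 0)) * rotGen l y i
    with hF
  have hFc : ∀ j, ContDiff ℝ 1 (F j) := by
    intro j
    refine ContDiff.sum fun i _ ↦ ?_
    have h1 : ContDiff ℝ 1 fun y : E3 ↦ cmp k i j y - (if i = j then trδ k y else 0) := by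
      by_cases h : i = j
      · subst h
        simp only [if_true]
        exact (contDiff_cmp hk i i).sub (contDiff_trδ hk)
      · simp only [h, if_false, sub_zero]
        exact contDiff_cmp hk i j
    exact h1.mul (contDiff_rotGen l i)
  have havg : ∀ ρ : ℝ, avgJ η ρ k l = ∫ x : E3, wt η ρ x * ∑ j, F j x * (x j / ‖x‖) := by
    intro ρ
    unfold avgJ
    refine integral_congr_ae (Eventually.of_forall fun x ↦ ?_)
    simp only [hF, Finset.sum_mul]
    rw [Finset.sum_comm]
  rw [havg r₁, havg r₀, integral_wt_flux_sub hη hr₀ hr₁ hFc]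
  rfl

end ChargeIdentities



/-! ## §4 The printed right-hand sides of the `C`- and `J`-rows for symmetric `g`, `k` -/

section PrintedForms

variable {r₀ r₁ : ℝ} {η : ℝ → ℝ} {g k : E3 → E3 →L[ℝ] E3 →L[ℝ] ℝ} {x : E3} {m : Fin 3}

/-- `∂_m` is additive on functions differentiable at the point. [folklore] -/
theorem pd_add {f₁ f₂ : E3 → ℝ} (h₁ : DifferentiableAt ℝ f₁ x) (h₂ : DifferentiableAt ℝ f₂ x) :
    pd m (fun y ↦ f₁ y + f₂ y) x = pd m f₁ x + pd m f₂ x := by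
  simp only [pd, fderiv_fun_add h₁ h₂, _root_.add_apply]

/-- `∂_m` of a difference of functions differentiable at the point. [folklore] -/
theorem pd_sub {f₁ f₂ : E3 → ℝ} (h₁ : DifferentiableAt ℝ f₁ x) (h₂ : DifferentiableAt ℝ f₂ x) :
    pd m (fun y ↦ f₁ y - f₂ y) x = pd m f₁ x - pd m f₂ x := by
  simp only [pd, fderiv_fun_sub h₁ h₂, FunLike.coe_sub, Pi.sub_apply]

/-- `∂_m` of a finite sum of functions differentiable at the point. [folklore] -/
theorem pd_sum {ι : Type*} (s : Finset ι) (f : ι → E3 → ℝ) (h : ∀ i ∈ s, DifferentiableAt ℝ (f i) x) :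
    pd m (fun y ↦ ∑ i ∈ s, f i y) x = ∑ i ∈ s, pd m (f i) x := by
  simp only [pd]
  rw [(HasFDerivAt.fun_sum fun i hi ↦ (h i hi).hasFDerivAt).fderiv, _root_.sum_apply]

/-- `∂_m (f − c) = ∂_m f` for a constant `c`. [folklore] -/
theorem pd_sub_const (f : E3 → ℝ) (c : ℝ) : pd m (fun y ↦ f y - c) x = pd m f x := by
  simp only [pd, fderiv_sub_const]

/-- `∂_m` commutes with a case distinction that does not depend on the point. [folklore] -/
theorem pd_ite (P : Prop) [Decidable P] (f : E3 → ℝ) :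
    pd m (fun y ↦ if P then f y else 0) x = if P then pd m f x else 0 := by
  by_cases h : P
  · simp [h]
  · simp [h, pd]

/-- Leibniz rule against a coordinate function: `∂_m (x_l f) = δ_{lm} f + x_l ∂_m f`. [folklore] -/
theorem pd_coord_mul (l : Fin 3) {f : E3 → ℝ} (hf : DifferentiableAt ℝ f x) :
    pd m (fun y : E3 ↦ y l * f y) x = (if l = m then 1 else 0) * f x + x l * pd m f x := by
  have hc : HasFDerivAt (fun y : E3 ↦ y l) (EuclideanSpace.proj (𝕜 := ℝ) l) x :=
    (EuclideanSpace.proj (𝕜 := ℝ) l).hasFDerivAt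
  have h : HasFDerivAt (fun y : E3 ↦ y l * f y)
      (x l • fderiv ℝ f x + f x • (EuclideanSpace.proj (𝕜 := ℝ) l : E3 →L[ℝ] ℝ)) x :=
    hc.mul hf.hasFDerivAt
  simp only [pd, h.fderiv, _root_.add_apply, _root_.smul_apply, smul_eq_mul]
  rw [EuclideanSpace.coe_proj]
  simp only [e, PiLp.single_apply]
  split_ifs <;> ring

/-- The components of a `C¹` coefficient field are differentiable. [folklore] -/
theorem differentiable_cmp (hg : ContDiff ℝ 1 g) (i j : Fin 3) : Differentiable ℝ (cmp g i j) :=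
  (contDiff_cmp hg i j).differentiable one_ne_zero

/-- `∂_m tr_δ g = Σ_i ∂_m g_{ii}`. [folklore] -/
theorem pd_trδ (hg : ContDiff ℝ 1 g) : pd m (trδ g) x = ∑ i, pd m (cmp g i i) x := by
  unfold trδ
  exact pd_sum _ (fun i y ↦ cmp g i i y) fun i _ ↦ (differentiable_cmp hg i i) x

/-- The divergence of the energy flux of (1.3) is the linearised scalar curvature:
`Σ_j ∂_j Σ_i (∂_i g_{ij} − ∂_j g_{ii}) = Σ_{i,j} (∂_j∂_i g_{ij} − ∂_j∂_j g_{ii}) = ∂_i∂_j h^{ij}`.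
[cite: MaoOhTao2023, §2.1 (2.3)] -/
theorem sum_pd_fluxE (hg : ContDiff ℝ 2 g) (x : E3) :
    ∑ j, pd j (fun y ↦ ∑ i, (pd i (cmp g i j) y - pd j (cmp g i i) y)) x =
      ∑ i, ∑ j, (pd j (pd i (cmp g i j)) x - pd j (pd j (cmp g i i)) x) := by
  have hpd : ∀ i j l, Differentiable ℝ (pd l (cmp g i j)) := fun i j l ↦
    (contDiff_pd (contDiff_cmp hg i j) l).differentiable one_ne_zero
  rw [Finset.sum_comm]
  refine Finset.sum_congr rfl fun j _ ↦ ?_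
  rw [pd_sum _ (fun i y ↦ pd i (cmp g i j) y - pd j (cmp g i i) y)
    fun i _ ↦ ((hpd i j i) x).sub ((hpd i i j) x)]
  refine Finset.sum_congr rfl fun i _ ↦ ?_
  exact pd_sub ((hpd i j i) x) ((hpd i i j) x)

/-- The centre-of-mass flux of (1.5) regrouped: `F^C_j = x_l F^E_j − (g_{lj} − δ_{lj}) + δ_{jl} (tr_δ g − 3)`, where
`F^E_j = Σ_i (∂_i g_{ij} − ∂_j g_{ii})` is the energy flux of (1.3). [cite: MaoOhTao2023, §1.2 (1.5)] -/
theorem fluxC_eq (g : E3 → E3 →L[ℝ] E3 →L[ℝ] ℝ) (l j : Fin 3) (y : E3) :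
    ∑ i, (y l * pd i (cmp g i j) y - y l * pd j (cmp g i i) y
        - (if i = l then cmp g i j y - (if i = j then 1 else 0) else 0)
        + (if j = l then cmp g i i y - 1 else 0)) =
      y l * ∑ i, (pd i (cmp g i j) y - pd j (cmp g i i) y)
        - (cmp g l j y - (if l = j then 1 else 0)) + (if j = l then trδ g y - 3 else 0) := by
  rw [Finset.sum_add_distrib, Finset.sum_sub_distrib, Finset.sum_ite_eq' Finset.univ l
    (fun i ↦ cmp g i j y - (if i = j then 1 else 0))]
  simp only [Finset.mem_univ, if_true, Finset.mul_sum, ← mul_sub]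
  by_cases h : j = l
  · simp only [h, if_true, trδ, Finset.sum_sub_distrib, Finset.sum_const, Finset.card_univ,
      Fintype.card_fin, nsmul_eq_mul, Nat.cast_ofNat, mul_one]
  · simp only [h, if_false, Finset.sum_const_zero]

/-- Leibniz rule for `∂_m` on functions differentiable at the point. [folklore] -/
theorem pd_mul {f₁ f₂ : E3 → ℝ} (h₁ : DifferentiableAt ℝ f₁ x) (h₂ : DifferentiableAt ℝ f₂ x) :
    pd m (fun y ↦ f₁ y * f₂ y) x = pd m f₁ x * f₂ x + f₁ x * pd m f₂ x := by
  have h : HasFDerivAt (fun y : E3 ↦ f₁ y * f₂ y) (f₁ x • fderiv ℝ f₂ x + f₂ x • fderiv ℝ f₁ x) x :=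
    h₁.hasFDerivAt.mul h₂.hasFDerivAt
  simp only [pd, h.fderiv, _root_.add_apply, _root_.smul_apply, smul_eq_mul]
  ring

/-- `∂_m x_a = δ_{am}`. [folklore] -/
theorem pd_coord (a : Fin 3) : pd m (fun y : E3 ↦ y a) x = if a = m then 1 else 0 := by
  have h := pd_coord_mul (x := x) (m := m) a (differentiableAt_const (1:ℝ))
  simp only [mul_one] at h
  rw [h]
  simp [pd]

/-- **`x_l` lies in the kernel of the formal adjoint of the double divergence**: for a symmetric `C²` field `g`, the
divergence of the centre-of-mass flux of (1.5) is `Σ_j ∂_j F^C_j = x_l ∂_i ∂_j h^{ij}` (the first-order remainder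
`Σ_i ∂_i g_{il} − Σ_j ∂_j g_{lj}` cancels by symmetry). [cite: MaoOhTao2023, Lemma 2.7 (proof)] -/
theorem sum_pd_fluxC_of_symm (hg : ContDiff ℝ 2 g) (hsymm : ∀ y i j, cmp g i j y = cmp g j i y) (l : Fin 3)
    (x : E3) :
    ∑ j, pd j (fun y : E3 ↦ ∑ i, (y l * pd i (cmp g i j) y - y l * pd j (cmp g i i) y
        - (if i = l then cmp g i j y - (if i = j then 1 else 0) else 0)
        + (if j = l then cmp g i i y - 1 else 0))) x =
      x l * ∑ i, ∑ j, (pd j (pd i (cmp g i j)) x - pd j (pd j (cmp g i i)) x) := by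
  have hg1 : ContDiff ℝ 1 g := hg.of_le (by norm_num)
  have hcmp : ∀ i j, Differentiable ℝ (cmp g i j) := fun i j ↦ differentiable_cmp hg1 i j
  have hpd : ∀ i j m, Differentiable ℝ (pd m (cmp g i j)) := fun i j m ↦
    (contDiff_pd (contDiff_cmp hg i j) m).differentiable one_ne_zero
  have hFE : ∀ j, Differentiable ℝ fun y ↦ ∑ i, (pd i (cmp g i j) y - pd j (cmp g i i) y) := fun j ↦
    Differentiable.fun_sum fun i _ ↦ (hpd i j i).sub (hpd i i j)
  have htr : Differentiable ℝ (trδ g) := (contDiff_trδ hg1).differentiable one_ne_zero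
  -- differentiate the regrouped flux `x_l F^E_j − (g_lj − δ_lj) + δ_jl (tr g − 3)` term by term
  have hterm : ∀ j, pd j (fun y : E3 ↦ ∑ i, (y l * pd i (cmp g i j) y - y l * pd j (cmp g i i) y
        - (if i = l then cmp g i j y - (if i = j then 1 else 0) else 0)
        + (if j = l then cmp g i i y - 1 else 0))) x =
      ((if l = j then 1 else 0) * (∑ i, (pd i (cmp g i j) x - pd j (cmp g i i) x))
        + x l * ∑ i, (pd j (pd i (cmp g i j)) x - pd j (pd j (cmp g i i)) x)
        - pd j (cmp g l j) x) + (if j = l then pd j (trδ g) x else 0) := by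
    intro j
    have hD : pd j (fun y ↦ ∑ i, (pd i (cmp g i j) y - pd j (cmp g i i) y)) x =
        ∑ i, (pd j (pd i (cmp g i j)) x - pd j (pd j (cmp g i i)) x) := by
      rw [pd_sum _ (fun i y ↦ pd i (cmp g i j) y - pd j (cmp g i i) y)
        fun i _ ↦ ((hpd i j i) x).sub ((hpd i i j) x)]
      exact Finset.sum_congr rfl fun i _ ↦ pd_sub ((hpd i j i) x) ((hpd i i j) x)
    have hre : (fun y : E3 ↦ ∑ i, (y l * pd i (cmp g i j) y - y l * pd j (cmp g i i) y
        - (if i = l then cmp g i j y - (if i = j then 1 else 0) else 0)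
        + (if j = l then cmp g i i y - 1 else 0))) =
      fun y ↦ (y l * ∑ i, (pd i (cmp g i j) y - pd j (cmp g i i) y)
        - (cmp g l j y - (if l = j then 1 else 0))) + (if j = l then trδ g y - 3 else 0) :=
      funext fun y ↦ fluxC_eq g l j y
    rw [hre]
    have d1 : DifferentiableAt ℝ (fun y : E3 ↦ y l * ∑ i, (pd i (cmp g i j) y - pd j (cmp g i i) y)) x :=
      ((EuclideanSpace.proj (𝕜 := ℝ) l).differentiableAt).mul ((hFE j) x)
    have d2 : DifferentiableAt ℝ (fun y : E3 ↦ cmp g l j y - (if l = j then 1 else 0)) x :=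
      ((hcmp l j) x).sub_const _
    have d3 : DifferentiableAt ℝ (fun y : E3 ↦ if j = l then trδ g y - 3 else 0) x := by
      by_cases h : j = l
      · simp only [h, if_true]; exact (htr x).sub_const _
      · simp only [h, if_false]; exact differentiableAt_const _
    have s1 : pd j (fun y ↦ (y l * ∑ i, (pd i (cmp g i j) y - pd j (cmp g i i) y)
          - (cmp g l j y - (if l = j then 1 else 0))) + (if j = l then trδ g y - 3 else 0)) x =
        pd j (fun y ↦ y l * ∑ i, (pd i (cmp g i j) y - pd j (cmp g i i) y)
          - (cmp g l j y - (if l = j then 1 else 0))) x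
          + pd j (fun y ↦ if j = l then trδ g y - 3 else 0) x := pd_add (d1.sub d2) d3
    have s2 : pd j (fun y ↦ y l * ∑ i, (pd i (cmp g i j) y - pd j (cmp g i i) y)
          - (cmp g l j y - (if l = j then 1 else 0))) x =
        pd j (fun y ↦ y l * ∑ i, (pd i (cmp g i j) y - pd j (cmp g i i) y)) x
          - pd j (fun y ↦ cmp g l j y - (if l = j then 1 else 0)) x := pd_sub d1 d2
    rw [s1, s2, pd_coord_mul l ((hFE j) x), pd_sub_const, pd_ite, pd_sub_const, hD]
  simp_rw [hterm]
  conv_rhs => rw [Finset.sum_comm]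
  -- sum over `j`: the main term plus a remainder which vanishes by symmetry
  simp only [Finset.sum_add_distrib, Finset.sum_sub_distrib, ite_mul, one_mul, zero_mul,
    Finset.sum_ite_eq, Finset.sum_ite_eq', Finset.mem_univ, if_true, ← Finset.mul_sum]
  rw [pd_trδ hg1]
  have hsf : ∀ i, pd i (cmp g l i) x = pd i (cmp g i l) x := fun i ↦ by
    rw [show cmp g l i = cmp g i l from funext fun y ↦ hsymm y l i]
  rw [show ∑ i, pd i (cmp g l i) x = ∑ i, pd i (cmp g i l) x from Finset.sum_congr rfl fun i _ ↦ hsf i]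
  ring

/-- **Conservation identity for the averaged centre of mass, printed form** (Mao–Oh–Tao 2023, Lemma 2.7, first
identity, `C`-rows, averaged): for a SYMMETRIC `C²` coefficient field `g`, radii `r₀, r₁ > 0` and `l = 1, 2, 3`,
`C_l[g; A_{r₁}] − C_l[g; A_{r₀}] = ½ ∫ χ_{r₀,r₁}(|x|) x_l ∂_i ∂_j h^{ij} (x) dx` (`x_l` lies in the kernel of the formal
adjoint of the double divergence, `sum_pd_fluxC_of_symm`). [cite: MaoOhTao2023, Lemma 2.7] -/
theorem avgC_sub_avgC_of_symm (hη : IsBump η) (hr₀ : 0 < r₀) (hr₁ : 0 < r₁) (hg : ContDiff ℝ 2 g)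
    (hsymm : ∀ y i j, cmp g i j y = cmp g j i y) (l : Fin 3) :
    avgC η r₁ g l - avgC η r₀ g l =
      (1 / 2) * ∫ x : E3, (∫ t in (0:ℝ)..‖x‖, (r₀⁻¹ * η (t / r₀) - r₁⁻¹ * η (t / r₁))) *
        (x l * ∑ i, ∑ j, (pd j (pd i (cmp g i j)) x - pd j (pd j (cmp g i i)) x)) := by
  rw [avgC_sub_avgC hη hr₀ hr₁ hg l]
  simp_rw [sum_pd_fluxC_of_symm hg hsymm l]

/-- The rotation fields are linear: `∂_m Y_l^i(x) = Y_l^i(e_m)`. [cite: MaoOhTao2023, §1.1] -/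
theorem pd_rotGen (l i : Fin 3) : pd m (fun y : E3 ↦ rotGen l y i) x = rotGen l (e m) i := by
  have hc : ∀ a : Fin 3, DifferentiableAt ℝ (fun y : E3 ↦ y a) x := fun a ↦
    (EuclideanSpace.proj (𝕜 := ℝ) a).differentiableAt
  have hcm : ∀ (c : ℝ) (a : Fin 3), DifferentiableAt ℝ (fun y : E3 ↦ c * y a) x := fun c a ↦
    (differentiableAt_const c).mul (hc a)
  have key : ∀ (c₁ c₂ : ℝ) (a b : Fin 3), pd m (fun y : E3 ↦ c₁ * y a - c₂ * y b) x =
      c₁ * (e m) a - c₂ * (e m) b := by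
    intro c₁ c₂ a b
    rw [pd_sub (hcm c₁ a) (hcm c₂ b), pd_mul (differentiableAt_const _) (hc a),
      pd_mul (differentiableAt_const _) (hc b), pd_coord, pd_coord]
    simp [pd, e, PiLp.single_apply, eq_comm]
  fin_cases i
  · simp only [rotGen, Fin.zero_eta, Matrix.cons_val_zero]
    exact key _ _ _ _
  · simp only [rotGen, Fin.mk_one, Matrix.cons_val_one, Matrix.cons_val_zero]
    exact key _ _ _ _
  · simp only [rotGen, Fin.reduceFinMk, Matrix.cons_val]
    exact key _ _ _ _

/-- **`Y_l` lies in the kernel of the formal adjoint of the symmetric divergence**: for a symmetric `C¹` field `k`,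
the divergence of the angular-momentum flux of (1.6) is `Σ_j ∂_j F^J_j = Σ_i Y_l^i Σ_j ∂_j π_{ij}` (the rotations are
Killing for `δ`: `Σ_{i,j} π_{ij} ∂_j Y_l^i = 0` as `∂_j Y_l^i` is antisymmetric and `π` symmetric).
[cite: MaoOhTao2023, Lemma 2.7 (proof)] -/
theorem sum_pd_fluxJ_of_symm (hk : ContDiff ℝ 1 k) (hsymm : ∀ y i j, cmp k i j y = cmp k j i y) (l : Fin 3)
    (x : E3) :
    ∑ j, pd j (fun y : E3 ↦ ∑ i, (cmp k i j y - (if i = j then trδ k y else 0)) * rotGen l y i) x =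
      ∑ i, rotGen l x i * ∑ j, pd j (fun y : E3 ↦ cmp k i j y - (if i = j then trδ k y else 0)) x := by
  have hcmp : ∀ i j, Differentiable ℝ (cmp k i j) := fun i j ↦ differentiable_cmp hk i j
  have htr : Differentiable ℝ (trδ k) := (contDiff_trδ hk).differentiable one_ne_zero
  have hπ : ∀ i j, Differentiable ℝ fun y : E3 ↦ cmp k i j y - (if i = j then trδ k y else 0) := by
    intro i j
    by_cases h : i = j
    · simp only [h, if_true]; exact (hcmp j j).sub htr
    · simp only [h, if_false]; exact (hcmp i j).sub (differentiable_const _)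
  have hY : ∀ i, Differentiable ℝ fun y : E3 ↦ rotGen l y i := fun i ↦
    (contDiff_rotGen l i).differentiable one_ne_zero
  have hterm : ∀ j, pd j (fun y : E3 ↦ ∑ i, (cmp k i j y - (if i = j then trδ k y else 0)) * rotGen l y i) x =
      ∑ i, (pd j (fun y : E3 ↦ cmp k i j y - (if i = j then trδ k y else 0)) x * rotGen l x i
        + (cmp k i j x - (if i = j then trδ k x else 0)) * rotGen l (e j) i) := by
    intro j
    rw [pd_sum _ (fun i y ↦ (cmp k i j y - (if i = j then trδ k y else 0)) * rotGen l y i)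
      fun i _ ↦ ((hπ i j) x).mul ((hY i) x)]
    refine Finset.sum_congr rfl fun i _ ↦ ?_
    rw [pd_mul ((hπ i j) x) ((hY i) x), pd_rotGen]
  simp_rw [hterm]
  rw [Finset.sum_comm]
  simp only [Finset.sum_add_distrib, Finset.mul_sum]
  have hanti : ∑ i, ∑ j, (cmp k i j x - (if i = j then trδ k x else 0)) * rotGen l (e j) i = 0 := by
    have hs : ∀ i j, cmp k i j x = cmp k j i x := fun i j ↦ hsymm x i j
    simp only [Fin.sum_univ_three, rotGen, e, PiLp.single_apply]
    fin_cases l <;> simp [hs 1 0, hs 2 0, hs 2 1]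
  rw [hanti, add_zero]
  refine Finset.sum_congr rfl fun i _ ↦ Finset.sum_congr rfl fun j _ ↦ ?_
  ring

/-- **Conservation identity for the averaged angular momentum, printed form** (Mao–Oh–Tao 2023, Lemma 2.7, second
identity, `J`-rows, averaged): for a SYMMETRIC `C¹` coefficient field `k`, radii `r₀, r₁ > 0` and `l = 1, 2, 3`,
`J_l[k; A_{r₁}] − J_l[k; A_{r₀}] = ∫ χ_{r₀,r₁}(|x|) Σ_i Y_l^i Σ_j ∂_j π_{ij} (x) dx` (`Y_l` lies in the kernel of the formal
adjoint of the symmetric divergence, `sum_pd_fluxJ_of_symm`). [cite: MaoOhTao2023, Lemma 2.7] -/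
theorem avgJ_sub_avgJ_of_symm (hη : IsBump η) (hr₀ : 0 < r₀) (hr₁ : 0 < r₁) (hk : ContDiff ℝ 1 k)
    (hsymm : ∀ y i j, cmp k i j y = cmp k j i y) (l : Fin 3) :
    avgJ η r₁ k l - avgJ η r₀ k l =
      ∫ x : E3, (∫ t in (0:ℝ)..‖x‖, (r₀⁻¹ * η (t / r₀) - r₁⁻¹ * η (t / r₁))) *
        ∑ i, rotGen l x i * ∑ j, pd j (fun y : E3 ↦ cmp k i j y - (if i = j then trδ k y else 0)) x := by
  rw [avgJ_sub_avgJ hη hr₀ hr₁ hk l]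
  simp_rw [sum_pd_fluxJ_of_symm hk hsymm l]

end PrintedForms

end MaoOhTao

end Literature.Geometry.Lorentzian

end
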